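import Summits.ValiantsHypothesis.ValiantsHypothesis.Theorems.KPlusLogSqLawStaticPathEvents

/-!
# Route «KPlusLogSqLaw» — parametric max-weight independent set on a path: THE EXCHANGE FORM OF THE EVENT TEST («events are particle moves»)

HONEST FRAMING.  Helper toward the crux `WeakLifting` (item `stmt-ValiantsHypothesis-19561`, route `KPlusLogSqLaw`, cell `pub-symmetroid`,
seat val-sym-lift-p4 g22, 2026-08-29) on the line of its witness-plan stub `stub_tridiagonalSectorB` (tropical twin of the STATIC tridiagonal
sector = parametric maximum-weight independent set on a path).  Sequel of `…StaticPathEvents` (`ne_iff_event`: across an adjacent transposition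
`(α, κ)` of the prefix-sum lines the unique optimum changes iff (flip)(L)(M)(R), a test phrased with the alternating FOLDS of the block and of the
reversed block; `toggle_ends_of_ne`).  Here the test is re-expressed WITHOUT folds, on the optimum `M` itself (memo PARTICLES.md, g22):
`sub_L_alt_eq_sum` (`S_κ - S_α` = signed sum of the item lines over the stretch `α+1, …, κ`); `mem_succ_iff_not_mem_of_indep` (if `M` and the
TOGGLED set `M ∆ {i+α+1, …, i+κ}` are both independent, membership in `M` alternates along the stretch); `sum_symmDiff_sub_eq` (so the toggle
changes the weight by `± (S_κ - S_α)` with a parameter-independent sign); **`ne_of_flip_of_indep_symmDiff`** (if the pair flips and the toggled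
set is independent, the unique optimum at `θ` is not optimal at `θ'` — no folds, no genericity beyond uniqueness); **`eq_symmDiff_of_ne`** (across
an event the new optimum IS the toggled set); **`ne_iff_flip_and_indep_symmDiff`** (THE EXCHANGE FORM: the optimum changes iff the pair flips AND
toggling the stretch keeps independence); `covered_of_ne_of_between` (no uncovered position strictly inside the stretch of an event).
Reading: with `V` = the uncovered positions («particles», an alternating chain) a same-parity crossing is an event iff one end is a particle and no
particle lies strictly between (a HOP), an opposite-parity crossing iff both ends are adjacent particles (ANNIHILATION) or both are covered with the
stretch tiled by `M` (CREATION).  Statements about a path DP; nothing here asserts anything about `WeakLifting`, `TropicalB`, `KPlusLogSqLaw`, the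
stub in its window, `MatrixDescartes` (stmt-ValiantsHypothesis-18050) or `VP ≠ VNP`; the ORDER QUESTION (hops `= O(n)`) stays open.
-/

set_option linter.dupNamespace false
set_option autoImplicit false

namespace Summit.ValiantsHypothesis.ValiantsHypothesis.Theorems.KPlusLogSqLaw

open Finset Classical
open scoped symmDiff

namespace StaticPathFold

noncomputable section

/-! ## 1. The prefix-sum difference over a stretch, and alternation along a doubly independent toggle -/

section Stretch

variable (w₁ w₀ : ℕ → ℝ)

/-- **`S_k - S_α` is the signed sum of the item lines over the stretch**: for `α ≤ k`,
`S_k(τ) - S_α(τ) = Σ_{t = i+α+1}^{i+k} (-1)^(t-i) · W_t(τ)` for the prefix-sum lines of the block `i+1, …`. [folklore] -/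
theorem sub_L_alt_eq_sum (i α : ℕ) (τ : ℝ) :
    ∀ k, α ≤ k →
      L (altA (shift i w₁)) (altB (shift i w₀)) k τ - L (altA (shift i w₁)) (altB (shift i w₀)) α τ =
        ∑ t ∈ Ioc (i + α) (i + k), (-1 : ℝ) ^ (t - i) * W w₁ w₀ t τ := by
  intro k hk
  induction k, hk using Nat.le_induction with
  | base => simp
  | succ k hk ih =>
    rw [show i + (k + 1) = i + k + 1 by ring, sum_Ioc_succ_top (by omega : i + α ≤ i + k), ← ih,
      L_alt_succ (shift i w₁) (shift i w₀) k τ, W_shift]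
    rw [show i + k + 1 - i = k + 1 by omega, show i + (k + 1) = i + k + 1 by ring]; ring

variable {w₁ w₀}

/-- **alternation along a doubly independent toggle**: if `M` and `M ∆ Ioc a b` are both independent (no two consecutive items), then for
`a < t`, `t + 1 ≤ b` one has `t + 1 ∈ M ↔ t ∉ M` — the items of the stretch `a+1, …, b` alternate in and out of `M`. [folklore] -/
theorem mem_succ_iff_not_mem_of_indep {M : Finset ℕ} {a b t : ℕ} (hM : Indep M) (hT : Indep (M ∆ Ioc a b))
    (hat : a < t) (htb : t + 1 ≤ b) : (t + 1 ∈ M ↔ t ∉ M) := by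
  constructor
  · intro h1 h0; exact hM t h0 h1
  · intro h0
    have htI : t ∈ Ioc a b := mem_Ioc.mpr ⟨hat, by omega⟩
    have ht1I : t + 1 ∈ Ioc a b := mem_Ioc.mpr ⟨by omega, htb⟩
    have htT : t ∈ M ∆ Ioc a b := Finset.mem_symmDiff.mpr (Or.inr ⟨htI, h0⟩)
    have ht1T : t + 1 ∉ M ∆ Ioc a b := hT t htT
    by_contra h1
    exact ht1T (Finset.mem_symmDiff.mpr (Or.inr ⟨ht1I, h1⟩))

/-- the weight of a toggled set minus the weight of the set is the signed sum over the toggled stretch (pure bookkeeping). [folklore] -/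
theorem sum_symmDiff_sub (M I : Finset ℕ) (f : ℕ → ℝ) :
    ∑ t ∈ M ∆ I, f t - ∑ t ∈ M, f t = ∑ t ∈ I, (if t ∈ M then -f t else f t) := by
  have hsd : M ∆ I = M.filter (fun t => t ∉ I) ∪ I.filter (fun t => t ∉ M) := by
    ext t
    simp only [Finset.mem_symmDiff, mem_union, mem_filter]
  have hdj : Disjoint (M.filter (fun t => t ∉ I)) (I.filter (fun t => t ∉ M)) := by
    rw [disjoint_left]
    intro t h1 h2
    rw [mem_filter] at h1 h2
    exact h2.2 h1.1
  rw [hsd, sum_union hdj, ← sum_filter_add_sum_filter_not M (fun t => t ∈ I) f, sum_ite]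
  have e : I.filter (fun t => t ∈ M) = M.filter (fun t => t ∈ I) := by
    ext t; simp only [mem_filter]; tauto
  rw [e, sum_neg_distrib]
  ring

/-- **the toggle changes the weight by `± (S_κ - S_α)`, with a parameter-independent sign**: if `M` and `M ∆ {i+α+1, …, i+κ}` are both
independent (`α < κ`), there is `s ∈ {1, -1}` with `Σ_{M ∆ stretch} W(τ) - Σ_M W(τ) = s · (S_κ(τ) - S_α(τ))` for every `τ`. [folklore] -/
theorem sum_symmDiff_sub_eq {M : Finset ℕ} {i α κ : ℕ} (hακ : α < κ) (hM : Indep M)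
    (hT : Indep (M ∆ Ioc (i + α) (i + κ))) :
    ∃ s : ℝ, (s = 1 ∨ s = -1) ∧ ∀ τ : ℝ,
      ∑ t ∈ M ∆ Ioc (i + α) (i + κ), W w₁ w₀ t τ - ∑ t ∈ M, W w₁ w₀ t τ =
        s * (L (altA (shift i w₁)) (altB (shift i w₀)) κ τ - L (altA (shift i w₁)) (altB (shift i w₀)) α τ) := by
  -- the sign pattern `ε t = -1` on `M`, `+1` off `M`, alternates along the stretch: `ε t = s (-1)^(t-i)`
  set ε : ℕ → ℝ := fun t => if t ∈ M then -1 else 1 with hε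
  set s : ℝ := ε (i + α + 1) * (-1) ^ (α + 1) with hs
  have hs1 : s = 1 ∨ s = -1 := by
    rcases neg_one_pow_eq_or ℝ (α + 1) with h | h <;>
      · by_cases hm : i + α + 1 ∈ M
        · simp [hs, hε, hm, h]
        · simp [hs, hε, hm, h]
  have hpat : ∀ t, i + α + 1 ≤ t → t ≤ i + κ → ε t = s * (-1) ^ (t - i) := by
    intro t ht
    induction t, ht using Nat.le_induction with
    | base =>
      intro _
      rw [hs, show i + α + 1 - i = α + 1 by omega, mul_assoc, ← pow_add, ← two_mul, pow_mul]
      norm_num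
    | succ t ht ih =>
      intro htκ
      have ih' := ih (by omega)
      have halt : (t + 1 ∈ M ↔ t ∉ M) := mem_succ_iff_not_mem_of_indep hM hT (by omega) htκ
      have e : t + 1 - i = (t - i) + 1 := by omega
      rw [e, pow_succ]
      by_cases h0 : t ∈ M
      · have h1 : t + 1 ∉ M := fun h1 => (halt.mp h1) h0
        have : ε t = -1 := by simp [hε, h0]
        rw [this] at ih'
        have : ε (t + 1) = 1 := by simp [hε, h1]
        rw [this]; linear_combination -ih'
      · have h1 : t + 1 ∈ M := halt.mpr h0
        have : ε t = 1 := by simp [hε, h0]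
        rw [this] at ih'
        have : ε (t + 1) = -1 := by simp [hε, h1]
        rw [this]; linear_combination -ih'
  refine ⟨s, hs1, fun τ => ?_⟩
  rw [sum_symmDiff_sub, sub_L_alt_eq_sum w₁ w₀ i α τ κ hακ.le, mul_sum]
  refine sum_congr rfl fun t ht => ?_
  have htb := mem_Ioc.mp ht
  have hε' : (if t ∈ M then -W w₁ w₀ t τ else W w₁ w₀ t τ) = ε t * W w₁ w₀ t τ := by
    by_cases h : t ∈ M <;> simp [hε, h]
  rw [hε', hpat t (by omega) htb.2]
  ring

end Stretch

/-! ## 2. A flipped pair with an independent toggle forces a change of the optimum -/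

section Sufficient

variable (w₁ w₀ : ℕ → ℝ)

/-- **SUFFICIENCY (no folds)**: let `M` be the unique optimal independent subset of the block `i+1, …, i+n` at `θ` and `M'` the unique optimum at
`θ'`; if the prefix-sum lines `S_α`, `S_κ` (`α < κ`) are in opposite orders at `θ` and at `θ'` and the toggled set `M ∆ {i+α+1, …, i+κ}` is an
independent subset of the block, then `M ≠ M'`.  [The toggled set beats `M` at `θ'`: its advantage is `± (S_κ - S_α)`, negative at `θ`
by uniqueness, hence positive at `θ'`.] [folklore] -/
theorem ne_of_flip_of_indep_symmDiff {i n α κ : ℕ} {θ θ' : ℝ} {M M' : Finset ℕ} (hακ : α < κ)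
    (hM : M ∈ indepSets i n)
    (huniq : ∀ T ∈ indepSets i n, T ≠ M → ∑ t ∈ T, W w₁ w₀ t θ < ∑ t ∈ M, W w₁ w₀ t θ)
    (huniq' : ∀ T ∈ indepSets i n, T ≠ M' → ∑ t ∈ T, W w₁ w₀ t θ' < ∑ t ∈ M', W w₁ w₀ t θ')
    (hflip : (L (altA (shift i w₁)) (altB (shift i w₀)) α θ < L (altA (shift i w₁)) (altB (shift i w₀)) κ θ ↔
      ¬ L (altA (shift i w₁)) (altB (shift i w₀)) α θ' < L (altA (shift i w₁)) (altB (shift i w₀)) κ θ'))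
    (hT : M ∆ Ioc (i + α) (i + κ) ∈ indepSets i n) :
    M ≠ M' := by
  intro hMM'
  set T := M ∆ Ioc (i + α) (i + κ) with hTdef
  have hTne : T ≠ M := by
    intro h
    have hmem : i + κ ∈ Ioc (i + α) (i + κ) := mem_Ioc.mpr ⟨by omega, le_rfl⟩
    have : (i + κ ∈ T ↔ i + κ ∈ M) := by rw [h]
    rw [hTdef, Finset.mem_symmDiff] at this
    tauto
  obtain ⟨s, hs, hsum⟩ := sum_symmDiff_sub_eq (w₁ := w₁) (w₀ := w₀) hακ (mem_indepSets.mp hM).2 (mem_indepSets.mp hT).2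
  have h1 : ∑ t ∈ T, W w₁ w₀ t θ - ∑ t ∈ M, W w₁ w₀ t θ < 0 := by linarith [huniq T hT hTne]
  have h2 : ∑ t ∈ T, W w₁ w₀ t θ' - ∑ t ∈ M, W w₁ w₀ t θ' < 0 := by
    have := huniq' T hT (hMM' ▸ hTne); rw [← hMM'] at this; linarith
  rw [hsum θ] at h1
  rw [hsum θ'] at h2
  set d := L (altA (shift i w₁)) (altB (shift i w₀)) κ θ - L (altA (shift i w₁)) (altB (shift i w₀)) α θ with hd
  set d' := L (altA (shift i w₁)) (altB (shift i w₀)) κ θ' - L (altA (shift i w₁)) (altB (shift i w₀)) α θ' with hd'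
  -- `s d < 0` and `s d' < 0` give `d`, `d'` the same strict sign, contradicting the flip
  rcases hs with rfl | rfl
  · have hdn : d < 0 := by linarith
    have hdn' : d' < 0 := by linarith
    exact (fun h => by rw [hd] at hdn; linarith) (hflip.mpr fun h => by rw [hd'] at hdn'; linarith)
  · have hdp : 0 < d := by linarith
    have hdp' : 0 < d' := by linarith
    exact (hflip.mp (by rw [hd] at hdp; linarith)) (by rw [hd'] at hdp'; linarith)

end Sufficient

/-! ## 3. Across an event the new optimum is the toggled set -/

section Necessary

variable (w₁ w₀ : ℕ → ℝ)

/-- **ACROSS AN EVENT THE OPTIMUM IS TOGGLED ON THE STRETCH**: across an adjacent transposition `(α, κ)`, `α < κ ≤ n`, of the prefix-sum lines of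
the block `i+1, …, i+n` (all other pairs keep their order, values distinct at both parameters, no third line between `S_α` and `S_κ` at `θ`), if the
unique optimum changes from `M` to `M'` then `M' = M ∆ {i+α+1, …, i+κ}`: the items of the stretch are toggled and no other item changes.
[From `toggle_ends_of_ne` (only the end POSITIONS change their uncovered-status) by reconstructing an independent set from its uncovered positions,
left to right.] [folklore] -/
theorem eq_symmDiff_of_ne {i n α κ : ℕ} {θ θ' : ℝ} {M M' : Finset ℕ} (hακ : α < κ) (hκn : κ ≤ n)
    (hM : M ∈ indepSets i n) (hM' : M' ∈ indepSets i n)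
    (huniq : ∀ T ∈ indepSets i n, T ≠ M → ∑ t ∈ T, W w₁ w₀ t θ < ∑ t ∈ M, W w₁ w₀ t θ)
    (huniq' : ∀ T ∈ indepSets i n, T ≠ M' → ∑ t ∈ T, W w₁ w₀ t θ' < ∑ t ∈ M', W w₁ w₀ t θ')
    (hord : ∀ p q, p ≤ n → q ≤ n → ¬(p = α ∧ q = κ) → ¬(p = κ ∧ q = α) →
      (L (altA (shift i w₁)) (altB (shift i w₀)) p θ < L (altA (shift i w₁)) (altB (shift i w₀)) q θ ↔
        L (altA (shift i w₁)) (altB (shift i w₀)) p θ' < L (altA (shift i w₁)) (altB (shift i w₀)) q θ'))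
    (hdis : ∀ p q, p ≤ n → q ≤ n → p ≠ q → L (altA (shift i w₁)) (altB (shift i w₀)) p θ ≠ L (altA (shift i w₁)) (altB (shift i w₀)) q θ)
    (hdis' : ∀ p q, p ≤ n → q ≤ n → p ≠ q → L (altA (shift i w₁)) (altB (shift i w₀)) p θ' ≠ L (altA (shift i w₁)) (altB (shift i w₀)) q θ')
    (hadj : ∀ x, x ≤ n → x ≠ α → x ≠ κ →
      (L (altA (shift i w₁)) (altB (shift i w₀)) x θ < L (altA (shift i w₁)) (altB (shift i w₀)) α θ ↔
        L (altA (shift i w₁)) (altB (shift i w₀)) x θ < L (altA (shift i w₁)) (altB (shift i w₀)) κ θ))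
    (hne : M ≠ M') :
    M' = M ∆ Ioc (i + α) (i + κ) := by
  obtain ⟨hα, hκ, hothers⟩ := toggle_ends_of_ne w₁ w₀ hακ hκn hM hM' huniq huniq' hord hdis hdis' hadj hne
  rcases mem_indepSets.mp hM with ⟨hM1, hM2⟩
  rcases mem_indepSets.mp hM' with ⟨hM1', hM2'⟩
  -- membership of `i + x` in `M` and in `M'` AGREES iff `x ∉ (α, κ]`, by induction on `x`
  have key : ∀ x, x ≤ n + 1 → ((i + x ∈ M ↔ i + x ∈ M') ↔ (x ≤ α ∨ κ < x)) := by
    intro x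
    induction x with
    | zero =>
      intro _
      have h0 : i + 0 ∉ M := fun h => by have := mem_Ioc.mp (hM1 h); omega
      have h0' : i + 0 ∉ M' := fun h => by have := mem_Ioc.mp (hM1' h); omega
      exact ⟨fun _ => Or.inl (Nat.zero_le α), fun _ => ⟨fun h => absurd h h0, fun h => absurd h h0'⟩⟩
    | succ x ih =>
      intro hx
      have ihx := ih (by omega)
      have hxn : x ≤ n := by omega
      show ((i + x + 1 ∈ M ↔ i + x + 1 ∈ M') ↔ (x + 1 ≤ α ∨ κ < x + 1))
      by_cases hin : i + x ∈ M
      · have hs : i + x + 1 ∉ M := hM2 _ hin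
        by_cases hag : (i + x ∈ M ↔ i + x ∈ M')
        · -- agree at `x`, `i + x ∈ M'`
          have hin' := hag.mp hin
          have hs' : i + x + 1 ∉ M' := hM2' _ hin'
          have hrx := ihx.mp hag
          refine ⟨fun _ => ?_, fun _ => ⟨fun h => absurd h hs, fun h => absurd h hs'⟩⟩
          rcases hrx with h | h
          · rcases Nat.lt_or_ge x α with h' | h'
            · exact Or.inl h'
            · -- `x = α`: both statuses at `α` are «covered», contradicting the toggle at `α`
              exfalso
              have hxα : x = α := le_antisymm h h'
              subst hxα
              exact hα ⟨fun h => absurd h.1 (not_not.mpr hin), fun h => absurd h.1 (not_not.mpr hin')⟩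
          · exact Or.inr (by omega)
        · -- disagree at `x`: `i + x ∉ M'`, and `α < x ≤ κ`
          have hin' : i + x ∉ M' := fun h => hag ⟨fun _ => h, fun _ => hin⟩
          have hrx : ¬ (x ≤ α ∨ κ < x) := fun h => hag (ihx.mpr h)
          push Not at hrx
          rcases Nat.lt_or_ge x κ with hxκ | hxκ
          · -- `x < κ`: status at `x` agrees (covered in `M`), so `i + x + 1 ∈ M'`
            have hxα : x ≠ α := by omega
            have hxκ' : x ≠ κ := by omega
            have e := hothers x hxn hxα hxκ'
            have hs' : i + x + 1 ∈ M' := by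
              by_contra h
              exact (e.mpr ⟨hin', h⟩).1 hin
            refine ⟨fun h => absurd (h.mpr hs') hs, fun h => ?_⟩
            exfalso; rcases h with h | h <;> omega
          · -- `x = κ`: the status at `κ` toggles: covered in `M`, uncovered in `M'`
            have hxκe : x = κ := le_antisymm hrx.2 hxκ
            subst hxκe
            have hs' : i + x + 1 ∉ M' := by
              by_contra h
              apply hκ
              exact ⟨fun hu => absurd hin hu.1, fun hu => absurd h hu.2⟩
            exact ⟨fun _ => Or.inr (by omega), fun _ => ⟨fun h => absurd h hs, fun h => absurd h hs'⟩⟩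
      · by_cases hag : (i + x ∈ M ↔ i + x ∈ M')
        · -- agree at `x`: `i + x ∉ M'`
          have hin' : i + x ∉ M' := fun h => hin (hag.mpr h)
          have hrx := ihx.mp hag
          rcases hrx with h | h
          · rcases Nat.lt_or_ge x α with h' | h'
            · -- `x < α`: statuses agree at `x`, hence membership of `i + x + 1` agrees
              have e := hothers x hxn (by omega) (by omega)
              refine ⟨fun _ => Or.inl (by omega), fun _ => ?_⟩
              constructor
              · intro h1; by_contra h1'; exact (e.mpr ⟨hin', h1'⟩).2 h1
              · intro h1'; by_contra h1; exact (e.mp ⟨hin, h1⟩).2 h1'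
            · -- `x = α`: the status at `α` toggles, so membership of `i + α + 1` differs
              have hxα : x = α := le_antisymm h h'
              subst hxα
              refine ⟨fun hag1 => ?_, fun h => ?_⟩
              · exfalso
                apply hα
                constructor
                · rintro ⟨_, h1⟩; exact ⟨hin', fun h1' => h1 (hag1.mpr h1')⟩
                · rintro ⟨_, h1'⟩; exact ⟨hin, fun h1 => h1' (hag1.mp h1)⟩
              · exfalso; rcases h with h | h <;> omega
          · -- `κ < x`: statuses agree at `x`
            have e := hothers x hxn (by omega) (by omega)
            refine ⟨fun _ => Or.inr (by omega), fun _ => ?_⟩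
            constructor
            · intro h1; by_contra h1'; exact (e.mpr ⟨hin', h1'⟩).2 h1
            · intro h1'; by_contra h1; exact (e.mp ⟨hin, h1⟩).2 h1'
        · -- disagree at `x`: `i + x ∈ M'`, `α < x ≤ κ`
          have hin' : i + x ∈ M' := by by_contra h; exact hag ⟨fun h' => absurd h' hin, fun h' => absurd h' h⟩
          have hs' : i + x + 1 ∉ M' := hM2' _ hin'
          have hrx : ¬ (x ≤ α ∨ κ < x) := fun h => hag (ihx.mpr h)
          push Not at hrx
          rcases Nat.lt_or_ge x κ with hxκ | hxκ
          · have e := hothers x hxn (by omega) (by omega)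
            have hs : i + x + 1 ∈ M := by
              by_contra h
              exact (e.mp ⟨hin, h⟩).1 hin'
            refine ⟨fun h => absurd (h.mp hs) hs', fun h => ?_⟩
            exfalso; rcases h with h | h <;> omega
          · have hxκe : x = κ := le_antisymm hrx.2 hxκ
            subst hxκe
            have hs : i + x + 1 ∉ M := by
              by_contra h
              apply hκ
              exact ⟨fun hu => absurd h hu.2, fun hu => absurd hin' hu.1⟩
            exact ⟨fun _ => Or.inr (by omega), fun _ => ⟨fun h => absurd h hs, fun h => absurd h hs'⟩⟩
  -- conclusion
  ext t
  rw [Finset.mem_symmDiff, mem_Ioc]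
  by_cases ht : i < t ∧ t ≤ i + n + 1
  · obtain ⟨x, rfl⟩ : ∃ x, t = i + x := ⟨t - i, by omega⟩
    have k := key x (by omega)
    by_cases hx : x ≤ α ∨ κ < x
    · have hag := k.mpr hx
      have hnot : ¬ (i + α < i + x ∧ i + x ≤ i + κ) := by omega
      constructor
      · intro h; exact Or.inl ⟨hag.mpr h, hnot⟩
      · rintro (⟨h, _⟩ | ⟨h, _⟩)
        · exact hag.mp h
        · exact absurd h hnot
    · have hdis_ : ¬ (i + x ∈ M ↔ i + x ∈ M') := fun h => hx (k.mp h)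
      have hyes : (i + α < i + x ∧ i + x ≤ i + κ) := by push Not at hx; omega
      constructor
      · intro h'; exact Or.inr ⟨hyes, fun h => hdis_ ⟨fun _ => h', fun _ => h⟩⟩
      · rintro (⟨h, hn⟩ | ⟨_, h⟩)
        · exact absurd hyes hn
        · by_contra h'; exact hdis_ ⟨fun hm => absurd hm h, fun hm' => absurd hm' h'⟩
  · have htM : t ∉ M := fun h => ht (by have := mem_Ioc.mp (hM1 h); omega)
    have htM' : t ∉ M' := fun h => ht (by have := mem_Ioc.mp (hM1' h); omega)
    have htI : ¬ (i + α < t ∧ t ≤ i + κ) := by omega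
    constructor
    · intro h; exact absurd h htM'
    · rintro (⟨h, _⟩ | ⟨h, _⟩)
      · exact absurd h htM
      · exact absurd h htI

/-- **THE EXCHANGE FORM OF THE EVENT TEST.**  Across an adjacent transposition `(α, κ)`, `α < κ ≤ n`, of the prefix-sum lines of the block
`i+1, …, i+n` (hypotheses of `ne_iff_event`), the unique optimal independent set CHANGES iff the pair `(S_α, S_κ)` changes order AND toggling the
items `i+α+1, …, i+κ` in the old optimum `M` yields an independent subset of the block (which is then the new optimum, `eq_symmDiff_of_ne`).
No fold appears in the statement: the test reads on `M` alone. [folklore] -/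
theorem ne_iff_flip_and_indep_symmDiff {i n α κ : ℕ} {θ θ' : ℝ} {M M' : Finset ℕ} (hακ : α < κ) (hκn : κ ≤ n)
    (hM : M ∈ indepSets i n) (hM' : M' ∈ indepSets i n)
    (huniq : ∀ T ∈ indepSets i n, T ≠ M → ∑ t ∈ T, W w₁ w₀ t θ < ∑ t ∈ M, W w₁ w₀ t θ)
    (huniq' : ∀ T ∈ indepSets i n, T ≠ M' → ∑ t ∈ T, W w₁ w₀ t θ' < ∑ t ∈ M', W w₁ w₀ t θ')
    (hord : ∀ p q, p ≤ n → q ≤ n → ¬(p = α ∧ q = κ) → ¬(p = κ ∧ q = α) →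
      (L (altA (shift i w₁)) (altB (shift i w₀)) p θ < L (altA (shift i w₁)) (altB (shift i w₀)) q θ ↔
        L (altA (shift i w₁)) (altB (shift i w₀)) p θ' < L (altA (shift i w₁)) (altB (shift i w₀)) q θ'))
    (hdis : ∀ p q, p ≤ n → q ≤ n → p ≠ q → L (altA (shift i w₁)) (altB (shift i w₀)) p θ ≠ L (altA (shift i w₁)) (altB (shift i w₀)) q θ)
    (hdis' : ∀ p q, p ≤ n → q ≤ n → p ≠ q → L (altA (shift i w₁)) (altB (shift i w₀)) p θ' ≠ L (altA (shift i w₁)) (altB (shift i w₀)) q θ')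
    (hadj : ∀ x, x ≤ n → x ≠ α → x ≠ κ →
      (L (altA (shift i w₁)) (altB (shift i w₀)) x θ < L (altA (shift i w₁)) (altB (shift i w₀)) α θ ↔
        L (altA (shift i w₁)) (altB (shift i w₀)) x θ < L (altA (shift i w₁)) (altB (shift i w₀)) κ θ)) :
    M ≠ M' ↔
      ((L (altA (shift i w₁)) (altB (shift i w₀)) α θ < L (altA (shift i w₁)) (altB (shift i w₀)) κ θ ↔
          ¬ L (altA (shift i w₁)) (altB (shift i w₀)) α θ' < L (altA (shift i w₁)) (altB (shift i w₀)) κ θ') ∧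
        M ∆ Ioc (i + α) (i + κ) ∈ indepSets i n) := by
  constructor
  · intro hne
    refine ⟨((ne_iff_event w₁ w₀ hακ hκn hM hM' huniq huniq' hord hdis hdis' hadj).mp hne).1, ?_⟩
    rw [← eq_symmDiff_of_ne w₁ w₀ hακ hκn hM hM' huniq huniq' hord hdis hdis' hadj hne]
    exact hM'
  · rintro ⟨hflip, hT⟩
    exact ne_of_flip_of_indep_symmDiff w₁ w₀ hακ hM huniq huniq' hflip hT

/-- **NO PARTICLE INSIDE THE STRETCH**: across an adjacent transposition `(α, κ)` at which the unique optimum changes, every position strictly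
between `α` and `κ` is COVERED by the old optimum `M` (and by the new one) — the items of the stretch alternate in and out of `M`. [folklore] -/
theorem covered_of_ne_of_between {i n α κ : ℕ} {θ θ' : ℝ} {M M' : Finset ℕ} (hακ : α < κ) (hκn : κ ≤ n)
    (hM : M ∈ indepSets i n) (hM' : M' ∈ indepSets i n)
    (huniq : ∀ T ∈ indepSets i n, T ≠ M → ∑ t ∈ T, W w₁ w₀ t θ < ∑ t ∈ M, W w₁ w₀ t θ)
    (huniq' : ∀ T ∈ indepSets i n, T ≠ M' → ∑ t ∈ T, W w₁ w₀ t θ' < ∑ t ∈ M', W w₁ w₀ t θ')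
    (hord : ∀ p q, p ≤ n → q ≤ n → ¬(p = α ∧ q = κ) → ¬(p = κ ∧ q = α) →
      (L (altA (shift i w₁)) (altB (shift i w₀)) p θ < L (altA (shift i w₁)) (altB (shift i w₀)) q θ ↔
        L (altA (shift i w₁)) (altB (shift i w₀)) p θ' < L (altA (shift i w₁)) (altB (shift i w₀)) q θ'))
    (hdis : ∀ p q, p ≤ n → q ≤ n → p ≠ q → L (altA (shift i w₁)) (altB (shift i w₀)) p θ ≠ L (altA (shift i w₁)) (altB (shift i w₀)) q θ)
    (hdis' : ∀ p q, p ≤ n → q ≤ n → p ≠ q → L (altA (shift i w₁)) (altB (shift i w₀)) p θ' ≠ L (altA (shift i w₁)) (altB (shift i w₀)) q θ')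
    (hadj : ∀ x, x ≤ n → x ≠ α → x ≠ κ →
      (L (altA (shift i w₁)) (altB (shift i w₀)) x θ < L (altA (shift i w₁)) (altB (shift i w₀)) α θ ↔
        L (altA (shift i w₁)) (altB (shift i w₀)) x θ < L (altA (shift i w₁)) (altB (shift i w₀)) κ θ))
    (hne : M ≠ M') {x : ℕ} (hαx : α < x) (hxκ : x < κ) :
    ¬ (i + x ∉ M ∧ i + x + 1 ∉ M) := by
  have hT : M ∆ Ioc (i + α) (i + κ) ∈ indepSets i n := by
    rw [← eq_symmDiff_of_ne w₁ w₀ hακ hκn hM hM' huniq huniq' hord hdis hdis' hadj hne]; exact hM'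
  have halt := mem_succ_iff_not_mem_of_indep (mem_indepSets.mp hM).2 (mem_indepSets.mp hT).2
    (show i + α < i + x by omega) (show i + x + 1 ≤ i + κ by omega)
  exact fun ⟨h0, h1⟩ => h1 (halt.mpr h0)

end Necessary

end

end StaticPathFold

end Summit.ValiantsHypothesis.ValiantsHypothesis.Theorems.KPlusLogSqLaw
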